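import Summits.ValiantsHypothesis.ValiantsHypothesis.Theorems.LacunarySymmetroidMatrixDescartesSeparatedWindowKit

/-!
# `MatrixDescartes` — kit for the LETTER-SEPARATED SECTOR, III: angular pigeonhole, the ray lower bound for
# the two-letter characteristic polynomial, entry and perturbation bounds for a real lacunary pencil

HONEST FRAMING.  Object-search cell `pub-symmetroid`, crux `Theses.LacunarySymmetroid.MatrixDescartes`
(ledger item `stmt-ValiantsHypothesis-18050`, route `LacunarySymmetroid`; seat `val-sym-mdr-p2`, gen 12).  The
crux implies `VP ≠ VNP` by the route's assembly; NOTHING here is progress on it and nothing here is a claim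
about `VP ≠ VNP`, `DoorA26` / `DoorA34` or the cell's registers.  Estimates for the structural two-letter
window law (`…SeparatedWindow.lean`):

* §5 **Angular avoidance** (`cos_le_of_separated`, `norm_sub_ge_of_cos_le`, `exists_angle_avoiding`): among
  the `m+1` angles `(2i+1)δ`, `δ = π/(2(m+1))`, some `θ ∈ [δ, π−δ]` is `δ`-far from `|arg y|` for every `y` in
  a given set of at most `m` complex numbers; then both rays `±θ` are `δ`-far in angle from every such `y`, and
  `‖w − y‖ ≥ sin δ · max ‖w‖ ‖y‖` for `w` on those rays.
* §6 **Ray lower bound** (`eval_norm_ge_of_separated`, `eval_norm_ge_on_ray`): for complex `A, B` with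
  `det B ≠ 0`, `p = det (X • B + A)` has degree `m`, leading coefficient `det B`, constant term `det A`
  (Mathlib `coeff_det_X_add_C_card`, `coeff_det_X_add_C_zero`), so through its root factorisation
  `‖p(w)‖ ≥ (sin δ)^m · max (‖det B‖‖w‖^m) ‖det A‖` whenever the direction of `w` is `δ`-far from every root.
* §7 **Pencil bounds at a complex point** (`norm_entry_sum_le`, `pencil_split`, `norm_det_one`,
  `norm_det_two_ge`, `norm_det_sub_two_le`): with `|S l i j| ≤ σ l`, `‖z‖ = x`,
  `E(x) = ∑_{l ≠ a,b} σ l x^(d l)`, `M(x) = σ a x^(d a) + σ b x^(d b)`: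
  `‖det F(z) − det(z^(d a)S a + z^(d b)S b)‖ ≤ m!·m·E(x)·(M(x)+E(x))^(m−1)` and
  `‖det(z^(d a)S a + z^(d b)S b)‖ ≥ |det S a|x^(m d a) − m!·m·σ b x^(d b)·M(x)^(m−1)` (Leibniz bound of kit I).

[folklore] Elementary; Mathlib `Complex.norm_mul_exp_arg_mul_I`, `Complex.arg_exp_mul_I`, `Real.mul_le_sin`,
`Polynomial.C_leadingCoeff_mul_prod_multiset_X_sub_C`.
-/

-- `Summit.ValiantsHypothesis.ValiantsHypothesis.…` repeats a component by the D-0017 layout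
-- (single-conjunct summit), which the `dupNamespace` linter flags; the name is mandated.
set_option linter.dupNamespace false

namespace Summit.ValiantsHypothesis.ValiantsHypothesis.Theorems.LacunarySymmetroidMatrixDescartes.Separated

open Polynomial Complex Set Finset
open scoped BigOperators Matrix Real

/-! ## §5 Angular avoidance: a ray missing the root arguments, and the resulting lower bound -/

/-- Cosine bounds from angular separation: if `δ ≤ θ ≤ π − δ`, `β ∈ (−π, π]` and `|θ − |β|| ≥ δ` then
`cos (θ − β) ≤ cos δ` and `cos (θ + β) ≤ cos δ` (the rays at angles `±θ` are `δ`-far from the direction `β`).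
[folklore] -/
theorem cos_le_of_separated {θ β δ : ℝ} (hδ : 0 ≤ δ) (hθ1 : δ ≤ θ) (hθ2 : θ ≤ π - δ)
    (hβ1 : -π < β) (hβ2 : β ≤ π) (hsep : δ ≤ |θ - abs β|) :
    Real.cos (θ - β) ≤ Real.cos δ ∧ Real.cos (θ + β) ≤ Real.cos δ := by
  -- two elementary facts
  have hA : ∀ u : ℝ, δ ≤ |u| → |u| ≤ π → Real.cos u ≤ Real.cos δ := by
    intro u hu1 hu2
    rw [← Real.cos_abs u]
    exact Real.cos_le_cos_of_nonneg_of_le_pi hδ hu2 hu1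
  have hB : ∀ u : ℝ, δ ≤ u → u ≤ 2 * π - δ → Real.cos u ≤ Real.cos δ := by
    intro u hu1 hu2
    rcases le_or_gt u π with h | h
    · exact Real.cos_le_cos_of_nonneg_of_le_pi hδ h hu1
    · rw [← Real.cos_two_pi_sub]
      exact Real.cos_le_cos_of_nonneg_of_le_pi hδ (by linarith) (by linarith)
  rcases le_or_gt 0 β with hb | hb
  · rw [abs_of_nonneg hb] at hsep
    refine ⟨hA _ hsep ?_, hB _ (by linarith [le_abs_self (θ - β), neg_abs_le (θ - β)]) (by linarith)⟩
    rw [abs_le]; constructor <;> linarith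
  · rw [abs_of_neg hb] at hsep
    refine ⟨hB _ (by linarith) (by linarith), ?_⟩
    have : θ + β = θ - (-β) := by ring
    rw [this]
    refine hA _ hsep ?_
    rw [abs_le]; constructor <;> linarith

/-- Distance lower bound from an angular separation: if `cos (arg w − arg y) ≤ cos δ` with `0 ≤ δ ≤ π/2`, then
`‖w − y‖ ≥ sin δ · max ‖w‖ ‖y‖`. [folklore] -/
theorem norm_sub_ge_of_cos_le {w y : ℂ} {δ : ℝ} (hδ : 0 ≤ δ) (hδ2 : δ ≤ π / 2)
    (hcos : Real.cos (arg w - arg y) ≤ Real.cos δ) :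
    Real.sin δ * max ‖w‖ ‖y‖ ≤ ‖w - y‖ := by
  have hsin : 0 ≤ Real.sin δ := Real.sin_nonneg_of_nonneg_of_le_pi hδ (by linarith [Real.pi_pos])
  -- `‖w − y‖² = ‖w‖² + ‖y‖² − 2‖w‖‖y‖ cos(arg w − arg y)`
  have hre : (w * (starRingEnd ℂ) y).re = ‖w‖ * ‖y‖ * Real.cos (arg w - arg y) := by
    have hw := norm_mul_exp_arg_mul_I w
    have hy := norm_mul_exp_arg_mul_I y
    have : w * (starRingEnd ℂ) y = (‖w‖ * ‖y‖ : ℝ) * exp ((arg w - arg y : ℝ) * I) := by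
      conv_lhs => rw [← hw, ← hy]
      rw [map_mul, Complex.conj_ofReal, ← Complex.exp_conj, map_mul, Complex.conj_ofReal, Complex.conj_I,
        ofReal_mul, ofReal_sub]
      rw [show (‖w‖ : ℂ) * exp (arg w * I) * ((‖y‖ : ℂ) * exp (arg y * -I)) =
        (‖w‖ : ℂ) * ‖y‖ * (exp (arg w * I) * exp (arg y * -I)) by ring, ← Complex.exp_add]
      congr 2
      ring
    rw [this, re_ofReal_mul, exp_ofReal_mul_I_re]
  have hsq : ‖w - y‖ ^ 2 = ‖w‖ ^ 2 + ‖y‖ ^ 2 - 2 * (‖w‖ * ‖y‖ * Real.cos (arg w - arg y)) := by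
    rw [← hre, Complex.sq_norm, Complex.sq_norm, Complex.sq_norm, Complex.normSq_sub]
  have hcs : Real.sin δ ^ 2 = 1 - Real.cos δ ^ 2 := by rw [Real.sin_sq]
  have hw0 := norm_nonneg w
  have hy0 := norm_nonneg y
  have hprod : ‖w‖ * ‖y‖ * Real.cos (arg w - arg y) ≤ ‖w‖ * ‖y‖ * Real.cos δ :=
    mul_le_mul_of_nonneg_left hcos (mul_nonneg hw0 hy0)
  have key : (Real.sin δ * max ‖w‖ ‖y‖) ^ 2 ≤ ‖w - y‖ ^ 2 := by
    rw [hsq, mul_pow, hcs]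
    rcases le_total ‖w‖ ‖y‖ with h | h
    · rw [max_eq_right h]
      nlinarith [sq_nonneg (‖y‖ * Real.cos δ - ‖w‖)]
    · rw [max_eq_left h]
      nlinarith [sq_nonneg (‖w‖ * Real.cos δ - ‖y‖)]
  exact (pow_le_pow_iff_left₀ (mul_nonneg hsin (le_max_of_le_left hw0)) (norm_nonneg _) two_ne_zero).1 key

/-- **Angular pigeonhole.**  For a finite set `Y` of at most `m` complex numbers there is an angle
`θ ∈ [δ, π − δ]`, `δ = π/(2(m+1))`, with `|θ − |arg y|| ≥ δ` for every `y ∈ Y` (among the `m+1` candidates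
`(2i+1)δ` each `y` spoils at most one). [folklore] -/
theorem exists_angle_avoiding (m : ℕ) (Y : Finset ℂ) (hY : Y.card ≤ m) :
    ∃ θ : ℝ, π / (2 * (m + 1)) ≤ θ ∧ θ ≤ π - π / (2 * (m + 1)) ∧
      ∀ y ∈ Y, π / (2 * (m + 1)) ≤ |θ - abs (arg y)| := by
  set δ : ℝ := π / (2 * (m + 1)) with hδ
  have hδ0 : 0 < δ := by positivity
  by_contra hcon
  push Not at hcon
  -- every candidate `(2i+1)δ` is spoiled by some `y i ∈ Y`
  have hcand : ∀ i : Fin (m + 1), ∃ y ∈ Y, |(2 * (i : ℝ) + 1) * δ - abs (arg y)| < δ := by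
    intro i
    have hi : (i : ℝ) ≤ m := by exact_mod_cast Nat.lt_succ_iff.1 i.isLt
    have h1 : δ ≤ (2 * (i : ℝ) + 1) * δ := by nlinarith [i.val.cast_nonneg (α := ℝ)]
    have h2 : (2 * (i : ℝ) + 1) * δ ≤ π - δ := by
      have : (2 * (i : ℝ) + 1) * δ + δ ≤ (2 * (m : ℝ) + 2) * δ := by nlinarith
      have e : (2 * (m : ℝ) + 2) * δ = π := by rw [hδ]; field_simp
      linarith
    exact hcon _ h1 h2
  choose f hfY hf using hcand
  have hinj : Function.Injective f := by
    intro i j hij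
    have hi := hf i
    have hj := hf j
    rw [hij] at hi
    have h2 : |(2 * (i : ℝ) + 1) * δ - (2 * (j : ℝ) + 1) * δ| < 2 * δ := by
      calc |(2 * (i : ℝ) + 1) * δ - (2 * (j : ℝ) + 1) * δ|
          = |((2 * (i : ℝ) + 1) * δ - |arg (f j)|) - ((2 * (j : ℝ) + 1) * δ - |arg (f j)|)| := by ring_nf
        _ ≤ |(2 * (i : ℝ) + 1) * δ - abs (arg (f j))| + |(2 * (j : ℝ) + 1) * δ - abs (arg (f j))| := abs_sub _ _
        _ < δ + δ := add_lt_add hi hj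
        _ = 2 * δ := by ring
    have h3 : |(2 * (i : ℝ) + 1) * δ - (2 * (j : ℝ) + 1) * δ| = 2 * δ * |(i : ℝ) - (j : ℝ)| := by
      rw [show (2 * (i : ℝ) + 1) * δ - (2 * (j : ℝ) + 1) * δ = 2 * δ * ((i : ℝ) - (j : ℝ)) by ring, abs_mul,
        abs_of_pos (by positivity : (0 : ℝ) < 2 * δ)]
    rw [h3] at h2
    have h4 : |(i : ℝ) - (j : ℝ)| < 1 := by
      by_contra hc
      rw [not_lt] at hc
      nlinarith
    have h5 : ((i : ℤ) : ℝ) - ((j : ℤ) : ℝ) = (i : ℝ) - (j : ℝ) := by push_cast; ring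
    have h6 : |((i : ℤ) - (j : ℤ) : ℤ)| < 1 := by
      have : |(((i : ℤ) - (j : ℤ) : ℤ) : ℝ)| < 1 := by push_cast; rw [h5] at *; exact h4
      exact_mod_cast this
    have h7 : (i : ℤ) = j := by
      have := abs_lt.1 h6
      omega
    exact Fin.ext (by exact_mod_cast h7)
  have hcard : m + 1 ≤ Y.card := by
    have := Finset.card_le_card_of_injOn (s := (Finset.univ : Finset (Fin (m + 1)))) f (fun i _ => hfY i)
      (hinj.injOn)
    simpa using this
  omega


/-! ## §6 Lower bound for the two-letter characteristic polynomial on a ray missing its root arguments -/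

/-- Norm of a multiset product of complex numbers. [folklore] -/
theorem norm_multiset_map_prod {ι : Type*} (s : Multiset ι) (f : ι → ℂ) :
    ‖(s.map f).prod‖ = (s.map fun i => ‖f i‖).prod := by
  induction s using Multiset.induction_on with
  | empty => simp
  | cons a s ih => rw [Multiset.map_cons, Multiset.prod_cons, norm_mul, ih, Multiset.map_cons, Multiset.prod_cons]

/-- **Ray lower bound.**  Let `A, B` be complex `m × m` matrices with `det B ≠ 0` and `p = det (X • B + A)`
(degree `m`, leading coefficient `det B`, constant term `det A`).  If `0 ≤ δ ≤ π/2` and every root `y` of `p`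
satisfies `cos (arg w − arg y) ≤ cos δ` (the direction of `w` is `δ`-far from every root direction), then
`‖p(w)‖ ≥ (sin δ)^m · max (‖det B‖·‖w‖^m) ‖det A‖`. [folklore] -/
theorem eval_norm_ge_of_separated {m : ℕ} (A B : Matrix (Fin m) (Fin m) ℂ) (hB : B.det ≠ 0) (w : ℂ)
    {δ : ℝ} (hδ : 0 ≤ δ) (hδ2 : δ ≤ π / 2)
    (hsep : ∀ y ∈ (Matrix.det ((X : ℂ[X]) • B.map C + A.map C)).roots,
      Real.cos (arg w - arg y) ≤ Real.cos δ) :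
    Real.sin δ ^ m * max (‖B.det‖ * ‖w‖ ^ m) ‖A.det‖ ≤
      ‖(Matrix.det ((X : ℂ[X]) • B.map C + A.map C)).eval w‖ := by
  set p : ℂ[X] := Matrix.det ((X : ℂ[X]) • B.map C + A.map C) with hp_def
  have hsin : 0 ≤ Real.sin δ := Real.sin_nonneg_of_nonneg_of_le_pi hδ (by linarith [Real.pi_pos])
  -- degree, leading coefficient, constant term
  have hcoeffm : p.coeff m = B.det := by
    have := coeff_det_X_add_C_card B A
    rwa [Fintype.card_fin] at this
  have hle : p.natDegree ≤ m := by
    have := natDegree_det_X_add_C_le B A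
    rwa [Fintype.card_fin] at this
  have hdeg : p.natDegree = m :=
    le_antisymm hle (le_natDegree_of_ne_zero (by rw [hcoeffm]; exact hB))
  have hlc : p.leadingCoeff = B.det := by rw [leadingCoeff, hdeg, hcoeffm]
  have h0 : p.eval 0 = A.det := by
    rw [← coeff_zero_eq_eval_zero]
    have := coeff_det_X_add_C_zero B A
    exact this
  have hroots : Multiset.card p.roots = p.natDegree := IsAlgClosed.card_roots_eq_natDegree
  have hcard : Multiset.card p.roots = m := hroots.trans hdeg
  have hfac := C_leadingCoeff_mul_prod_multiset_X_sub_C hroots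
  rw [hlc] at hfac
  -- evaluation through the factorisation
  have heval : ∀ z : ℂ, p.eval z = B.det * (p.roots.map fun y => z - y).prod := by
    intro z
    conv_lhs => rw [← hfac]
    rw [eval_mul, eval_C, eval_multiset_prod, Multiset.map_map]
    congr 2
    refine Multiset.map_congr rfl fun y _ => ?_
    simp
  have hnorm : ‖p.eval w‖ = ‖B.det‖ * (p.roots.map fun y => ‖w - y‖).prod := by
    rw [heval, norm_mul, norm_multiset_map_prod]
  have hnorm0 : ‖A.det‖ = ‖B.det‖ * (p.roots.map fun y => ‖y‖).prod := by
    rw [← h0, heval, norm_mul, norm_multiset_map_prod]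
    congr 1
    refine congrArg _ (Multiset.map_congr rfl fun y _ => ?_)
    rw [zero_sub, norm_neg]
  -- the termwise lower bound
  have hterm : (p.roots.map fun y => Real.sin δ * max ‖w‖ ‖y‖).prod ≤ (p.roots.map fun y => ‖w - y‖).prod :=
    Multiset.prod_map_le_prod_map₀ _ _ (fun y _ => mul_nonneg hsin (le_max_of_le_left (norm_nonneg _)))
      (fun y hy => norm_sub_ge_of_cos_le hδ hδ2 (hsep y hy))
  have hsplit : (p.roots.map fun y => Real.sin δ * max ‖w‖ ‖y‖).prod =
      Real.sin δ ^ m * (p.roots.map fun y => max ‖w‖ ‖y‖).prod := by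
    rw [Multiset.prod_map_mul, Multiset.map_const', Multiset.prod_replicate, hcard]
  have hmax1 : ‖w‖ ^ m ≤ (p.roots.map fun y => max ‖w‖ ‖y‖).prod := by
    have := Multiset.prod_map_le_prod_map₀ (fun _ => ‖w‖) (fun y => max ‖w‖ ‖y‖) (s := p.roots)
      (fun _ _ => norm_nonneg _) (fun y _ => le_max_left _ _)
    rwa [Multiset.map_const', Multiset.prod_replicate, hcard] at this
  have hmax2 : (p.roots.map fun y => ‖y‖).prod ≤ (p.roots.map fun y => max ‖w‖ ‖y‖).prod :=
    Multiset.prod_map_le_prod_map₀ _ _ (fun _ _ => norm_nonneg _) (fun y _ => le_max_right _ _)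
  have hPnonneg : 0 ≤ (p.roots.map fun y => max ‖w‖ ‖y‖).prod :=
    Multiset.prod_nonneg fun x hx => by
      obtain ⟨y, -, rfl⟩ := Multiset.mem_map.1 hx
      exact le_max_of_le_left (norm_nonneg _)
  have hB0 : 0 ≤ ‖B.det‖ := norm_nonneg _
  rw [hnorm]
  calc Real.sin δ ^ m * max (‖B.det‖ * ‖w‖ ^ m) ‖A.det‖
      ≤ Real.sin δ ^ m * (‖B.det‖ * (p.roots.map fun y => max ‖w‖ ‖y‖).prod) := by
        refine mul_le_mul_of_nonneg_left (max_le ?_ ?_) (pow_nonneg hsin _)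
        · exact mul_le_mul_of_nonneg_left hmax1 hB0
        · rw [hnorm0]; exact mul_le_mul_of_nonneg_left hmax2 hB0
    _ = ‖B.det‖ * (p.roots.map fun y => Real.sin δ * max ‖w‖ ‖y‖).prod := by rw [hsplit]; ring
    _ ≤ ‖B.det‖ * (p.roots.map fun y => ‖w - y‖).prod := mul_le_mul_of_nonneg_left hterm hB0

/-- On the ray `w = r·e^(±iθ)` (`r > 0`) with `θ ∈ [δ, π − δ]` `δ`-far from `|arg y|` for every root `y` of
`p = det (X • B + A)`: `‖p(w)‖ ≥ (sin δ)^m · max (‖det B‖ r^m) ‖det A‖`. [folklore] -/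
theorem eval_norm_ge_on_ray {m : ℕ} (A B : Matrix (Fin m) (Fin m) ℂ) (hB : B.det ≠ 0) {r θ δ : ℝ}
    (hr : 0 < r) (hδ : 0 ≤ δ) (hδ2 : δ ≤ π / 2) (hθ1 : δ ≤ θ) (hθ2 : θ ≤ π - δ) (hθπ : θ < π)
    (hsep : ∀ y ∈ (Matrix.det ((X : ℂ[X]) • B.map C + A.map C)).roots, δ ≤ |θ - abs (arg y)|)
    (s : ℝ) (hs : s = 1 ∨ s = -1) :
    Real.sin δ ^ m * max (‖B.det‖ * r ^ m) ‖A.det‖ ≤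
      ‖(Matrix.det ((X : ℂ[X]) • B.map C + A.map C)).eval ((r : ℂ) * exp ((s * θ : ℝ) * I))‖ := by
  have hw : ‖(r : ℂ) * exp ((s * θ : ℝ) * I)‖ = r := by
    rw [norm_mul, Complex.norm_real, Real.norm_eq_abs, abs_of_pos hr, Complex.norm_exp_ofReal_mul_I, mul_one]
  have harg : arg ((r : ℂ) * exp ((s * θ : ℝ) * I)) = s * θ := by
    rw [arg_real_mul _ hr, arg_exp_mul_I, toIocMod_eq_self]
    have hπ := Real.pi_pos
    constructor
    · rcases hs with h | h <;> subst h <;> linarith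
    · rcases hs with h | h <;> subst h <;> linarith
  have h := eval_norm_ge_of_separated A B hB ((r : ℂ) * exp ((s * θ : ℝ) * I)) hδ hδ2 ?_
  · rwa [hw] at h
  · intro y hy
    rw [harg]
    have hc := cos_le_of_separated hδ hθ1 hθ2 (neg_pi_lt_arg y) (arg_le_pi y) (hsep y hy)
    rcases hs with h | h <;> subst h
    · simpa using hc.1
    · have : (-1 : ℝ) * θ - arg y = -(θ + arg y) := by ring
      rw [this, Real.cos_neg]
      exact hc.2


/-! ## §7 Entry bounds for a real lacunary pencil at a complex point -/

section Pencil

variable {K m : ℕ} (d : Fin K → ℕ) (S : Fin K → Matrix (Fin m) (Fin m) ℝ) (σ : Fin K → ℝ)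

/-- `‖algebraMap ℝ ℂ r‖ = |r|`. [folklore] -/
theorem norm_algebraMap_real (r : ℝ) : ‖algebraMap ℝ ℂ r‖ = |r| := by
  change ‖(r : ℂ)‖ = |r|
  rw [Complex.norm_real, Real.norm_eq_abs]

/-- Entries of `∑_{l ∈ R} z^(d l) • S l` are bounded by `∑_{l ∈ R} σ l ‖z‖^(d l)`. [folklore] -/
theorem norm_entry_sum_le (hσ : ∀ l i j, |S l i j| ≤ σ l) (R : Finset (Fin K)) (z : ℂ) (i j : Fin m) :
    ‖(∑ l ∈ R, (z ^ d l) • (S l).map (algebraMap ℝ ℂ)) i j‖ ≤ ∑ l ∈ R, σ l * ‖z‖ ^ d l := by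
  rw [Matrix.sum_apply]
  refine (norm_sum_le _ _).trans (Finset.sum_le_sum fun l _ => ?_)
  rw [Matrix.smul_apply, Matrix.map_apply, smul_eq_mul, norm_mul, norm_pow, norm_algebraMap_real, mul_comm]
  exact mul_le_mul_of_nonneg_right (hσ l i j) (pow_nonneg (norm_nonneg _) _)

/-- Entries of the two-letter part `z^(d a) • S a + z^(d b) • S b`. [folklore] -/
theorem norm_entry_two_le (hσ : ∀ l i j, |S l i j| ≤ σ l) (a b : Fin K) (z : ℂ) (i j : Fin m) :
    ‖((z ^ d a) • (S a).map (algebraMap ℝ ℂ) + (z ^ d b) • (S b).map (algebraMap ℝ ℂ)) i j‖ ≤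
      σ a * ‖z‖ ^ d a + σ b * ‖z‖ ^ d b := by
  rw [Matrix.add_apply]
  refine (norm_add_le _ _).trans (add_le_add ?_ ?_) <;>
  · rw [Matrix.smul_apply, Matrix.map_apply, smul_eq_mul, norm_mul, norm_pow, norm_algebraMap_real, mul_comm]
    exact mul_le_mul_of_nonneg_right (hσ _ i j) (pow_nonneg (norm_nonneg _) _)

/-- Entries of one letter `z^(d a) • S a`. [folklore] -/
theorem norm_entry_one_le (hσ : ∀ l i j, |S l i j| ≤ σ l) (a : Fin K) (z : ℂ) (i j : Fin m) :
    ‖((z ^ d a) • (S a).map (algebraMap ℝ ℂ)) i j‖ ≤ σ a * ‖z‖ ^ d a := by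
  rw [Matrix.smul_apply, Matrix.map_apply, smul_eq_mul, norm_mul, norm_pow, norm_algebraMap_real, mul_comm]
  exact mul_le_mul_of_nonneg_right (hσ _ i j) (pow_nonneg (norm_nonneg _) _)

/-- Splitting the pencil into the two-letter part and the rest. [folklore] -/
theorem pencil_split {a b : Fin K} (hab : a ≠ b) (z : ℂ) :
    (∑ l, (z ^ d l) • (S l).map (algebraMap ℝ ℂ)) =
      ((z ^ d a) • (S a).map (algebraMap ℝ ℂ) + (z ^ d b) • (S b).map (algebraMap ℝ ℂ)) +
        ∑ l ∈ (Finset.univ.erase a).erase b, (z ^ d l) • (S l).map (algebraMap ℝ ℂ) := by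
  have hb : b ∈ Finset.univ.erase a := Finset.mem_erase.2 ⟨hab.symm, Finset.mem_univ b⟩
  rw [← Finset.add_sum_erase _ _ (Finset.mem_univ a), ← Finset.add_sum_erase _ _ hb, add_assoc]

/-- Norm of the determinant of one letter at a complex point: `‖det (z^(d a) S a)‖ = ‖z‖^(m·d a)·|det S a|`.
[folklore] -/
theorem norm_det_one (a : Fin K) (z : ℂ) :
    ‖Matrix.det ((z ^ d a) • (S a).map (algebraMap ℝ ℂ))‖ = |(S a).det| * ‖z‖ ^ (m * d a) := by
  rw [Matrix.det_smul, Fintype.card_fin, norm_mul, norm_pow, norm_pow, ← pow_mul, mul_comm (d a) m]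
  have : ((S a).map (algebraMap ℝ ℂ)).det = algebraMap ℝ ℂ (S a).det := by
    rw [RingHom.map_det, RingHom.mapMatrix_apply]
  rw [this, Complex.coe_algebraMap, Complex.norm_real, Real.norm_eq_abs, mul_comm]

/-- **Vertical-side bound.**  At any complex point `z` with `‖z‖ = x`:
`‖det(z^(d a) S a + z^(d b) S b)‖ ≥ |det S a|·x^(m d a) − m!·m·(σ b x^(d b))·(σ a x^(d a) + σ b x^(d b))^(m−1)`. [folklore] -/
theorem norm_det_two_ge (hσ : ∀ l i j, |S l i j| ≤ σ l) (hσ0 : ∀ l, 0 ≤ σ l) (a b : Fin K) (z : ℂ) :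
    |(S a).det| * ‖z‖ ^ (m * d a) -
        (m.factorial : ℝ) * (m * (σ b * ‖z‖ ^ d b) * (σ a * ‖z‖ ^ d a + σ b * ‖z‖ ^ d b) ^ (m - 1)) ≤
      ‖Matrix.det ((z ^ d a) • (S a).map (algebraMap ℝ ℂ) + (z ^ d b) • (S b).map (algebraMap ℝ ℂ))‖ := by
  have h := norm_det_add_sub_det_le' ((z ^ d a) • (S a).map (algebraMap ℝ ℂ))
    ((z ^ d b) • (S b).map (algebraMap ℝ ℂ)) (μ := σ a * ‖z‖ ^ d a) (ε := σ b * ‖z‖ ^ d b)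
    (mul_nonneg (hσ0 a) (pow_nonneg (norm_nonneg _) _)) (mul_nonneg (hσ0 b) (pow_nonneg (norm_nonneg _) _))
    (norm_entry_one_le d S σ hσ a z) (norm_entry_one_le d S σ hσ b z)
  rw [← norm_det_one d S a z]
  have := norm_sub_norm_le (Matrix.det ((z ^ d a) • (S a).map (algebraMap ℝ ℂ)))
    (Matrix.det ((z ^ d a) • (S a).map (algebraMap ℝ ℂ) + (z ^ d b) • (S b).map (algebraMap ℝ ℂ)))
  rw [norm_sub_rev] at this
  linarith

/-- **Perturbation bound.**  At any complex point `z` with `‖z‖ = x`, writing `E(x) = ∑_{l ≠ a,b} σ l x^(d l)`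
and `M(x) = σ a x^(d a) + σ b x^(d b)`:
`‖det F(z) − det(z^(d a) S a + z^(d b) S b)‖ ≤ m!·m·E(x)·(M(x) + E(x))^(m−1)`. [folklore] -/
theorem norm_det_sub_two_le (hσ : ∀ l i j, |S l i j| ≤ σ l) (hσ0 : ∀ l, 0 ≤ σ l) {a b : Fin K} (hab : a ≠ b)
    (z : ℂ) :
    ‖Matrix.det (∑ l, (z ^ d l) • (S l).map (algebraMap ℝ ℂ)) -
        Matrix.det ((z ^ d a) • (S a).map (algebraMap ℝ ℂ) + (z ^ d b) • (S b).map (algebraMap ℝ ℂ))‖ ≤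
      (m.factorial : ℝ) * (m * (∑ l ∈ (Finset.univ.erase a).erase b, σ l * ‖z‖ ^ d l) *
        (σ a * ‖z‖ ^ d a + σ b * ‖z‖ ^ d b + ∑ l ∈ (Finset.univ.erase a).erase b, σ l * ‖z‖ ^ d l) ^ (m - 1)) := by
  rw [pencil_split d S hab z]
  exact norm_det_add_sub_det_le' _ _
    (add_nonneg (mul_nonneg (hσ0 a) (pow_nonneg (norm_nonneg _) _))
      (mul_nonneg (hσ0 b) (pow_nonneg (norm_nonneg _) _)))
    (Finset.sum_nonneg fun l _ => mul_nonneg (hσ0 l) (pow_nonneg (norm_nonneg _) _))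
    (norm_entry_two_le d S σ hσ a b z) (norm_entry_sum_le d S σ hσ _ z)

end Pencil


end Summit.ValiantsHypothesis.ValiantsHypothesis.Theorems.LacunarySymmetroidMatrixDescartes.Separated
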